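import Literature.AlgebraicGeometry.Motives.HodgeStructureExteriorAlgebraWeylOperatorDirectSum
import Literature.AlgebraicGeometry.Motives.HodgeStructureExteriorAlgebraSelfAdjoint
import Literature.AlgebraicGeometry.Motives.HodgeStructureExteriorPowerDuality
import HarnessLib

/-!
# The Künneth isomorphism `⋀W₁ ⊗ ⋀W₂ ≅ ⋀(W₁ ⊕ W₂)` as a linear equivalence, `∫_{X×Y} = ∫_X ⊗ ∫_Y`, Poincaré duality of
# the exterior algebra of a symplectic space, and the Gysin map of a projection with its projection formula

[topic AlgebraicGeometry/Motives]

Layer `Literature/AlgebraicGeometry/Motives`, lane `lit-hodgefound` (Track 2 foundations library; prover seat `lit-hodgefound-p34`,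
generation 32, row g32-#1). DEFINITIONS WITH BODIES (`kunnethEquiv`, `gysinSnd` — linear-algebra plumbing, no notion of the
literature is introduced) + THEOREMS; no named fact, no instance, no notation (net debt `0`). First file of the programme «Milne
1999 §5 (correspondences) on the Motives carrier»: the linear algebra of `H•(A × B) = ⋀(H¹A ⊕ H¹B)` needed to read Milne's
dictionary `u ↦ ū`, `ū(x) = q_*(p^*x ∪ u)` (row g32-#2) and Prop. 5.7 / Cor. 5.8 / Thm. 5.9 AS PRINTED (rows g32-#3/#4).

THE SETTING. `W₁`, `W₂` are vector spaces over a field `K`; from §2 on they carry symplectic 2-vectors `ω₁ ∈ ⋀²W₁` of genus `g₁`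
and `ω₂ ∈ ⋀²W₂` of genus `g₂` (`dim Wᵢ = 2gᵢ`), `W₁ × W₂` carries `ω₁ ⊞ ω₂ := ⋀(inl) ω₁ + ⋀(inr) ω₂` (symplectic of genus
`g₁ + g₂`, row g31-#9 `IsSymplectic.inl_add_inr`), and `τ_ω = trace ω g : ⋀W → K` is the top-degree trace of Q454
(`HodgeStructureExteriorPowerLefschetzDual`: the coefficient of `ω^g/g!`, "`∫_X`"). For abelian varieties `A`, `B`:
`Wᵢ = H¹`, `⋀Wᵢ = H•`, `p^* = ⋀(inl)`, `q^* = ⋀(inr)`, `η_A = τ_{ω₁}`, `η_{A×B} = τ_{ω₁⊞ω₂}`.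

## Sources, VERBATIM

J. S. Milne, *Lefschetz classes on abelian varieties*, Duke Math. J. **96** (1999) [Milne1999LefschetzClasses] (held text
`paper:doi-10-1215-s0012-7094-99-09620-5`, p0024–p0026 = pp. 662–664): "A regular map `φ: X → Y` of smooth projective varieties
induces a homomorphism `φ^* : H^*(Y) → H^*(X)` of graded `k`-algebras and homomorphisms `φ_* : H^s(X)(r) → H^{s+2c}(Y)(r + c)`,
`c = dim Y − dim X`" (p. 662); proof of Prop. 5.4 (p. 663): "the projection formula `η_B(φ_*(x) ∪ y) = η_A(x ∪ φ^*(y))`";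
p. 664: "The elements of `H^{2*}(X × Y)(*)` are called cohomological correspondences between `X` and `Y`. The map sending
`u ∈ H^{2s}(X × Y)(s)` to the composite `H^*(X) —p^*→ H^*(X × Y) —(v ↦ v ∪ u)→ H^{*+2s}(X × Y)(s) —q_*→ H^{*+2s−2d}(Y)(s − d)`,
`d = dim X`, is an isomorphism `u ↦ ū : H^*(X × Y) → Hom(H^*(X), H^{*+2s−2d}(Y)(s − d))`."
C. Voisin, *Hodge Theory and Complex Algebraic Geometry I* (2002) [VoisinHodgeI2002], §11.3.3 Thm. 11.38 (Künneth:
"The cup-products `Hᵖ(X, ℤ) ⊗ H^q(Y, ℤ) → H^{p+q}(X × Y, ℤ)` induce an isomorphism […]") and (11.11) "`α̃(η) = ⟨η, β⟩_X γ`" for `α = β ⊗ γ`.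
N. Bourbaki, *Algebra I*, Ch. III §7 no. 7 Prop. 10 and its Remark [BourbakiAlgebraI1989] (`⋀(M ⊕ N) ≅ ⋀(M) ᵍ⊗ ⋀(N)`,
`g(a ⊗ b) = ⋀(j₁)(a) ∧ ⋀(j₂)(b)`; naturality `g_N ∘ (⋀(v₁) ᵍ⊗ ⋀(v₂)) = ⋀(v) ∘ g_M`) — the tree's
`LinearAlgebra/Alternating/ExteriorAlgebraDirectSum` (`toProd`, `prodEquiv`).
H. Lange, *Abelian Varieties over the Complex Numbers* (2023) [Lange2023AbelianVarietiesComplex], §6.2.2 Thm. 6.2.4 (projection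
formula) and (6.8).

## What is PROVED (and the two definitions)

* §1 **`kunnethEquiv K W₁ W₂ : ⋀W₁ ⊗[K] ⋀W₂ ≃ₗ[K] ⋀(W₁ × W₂)`** — Bourbaki's isomorphism `g` of the tree (`toProd`), precomposed with
  the cast `GradedTensorProduct.of` out of the ORDINARY tensor product, AS A LINEAR EQUIVALENCE (it is the map
  `Φ = toProd ∘ of` of row g31-#9, `coe_kunnethEquiv`, so all the Lefschetz-module intertwinings of that row apply verbatim):
  `kunnethEquiv_tmul` (`Φ(x ⊗ y) = ⋀(inl) x ∧ ⋀(inr) y`), `kunnethEquiv_tmul_mem` (`⋀ᵃ ⊗ ⋀ᵇ → ⋀^{a+b}`), NATURALITY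
  `map_prodMap_kunnethEquiv` (`⋀(f₁ × f₂) ∘ Φ = Φ ∘ (⋀f₁ ⊗ ⋀f₂)`, the Remark after Prop. 10).
* §2 **THE PRODUCT FORMULA `IsSymplectic.trace_kunnethEquiv_tmul`: `τ_{ω₁⊞ω₂}(Φ(a ⊗ b)) = τ_{ω₁}(a) · τ_{ω₂}(b)`**
  ("`∫_{X×Y} p^*a ∪ q^*b = ∫_X a · ∫_Y b`"), through `IsSymplectic.inl_add_inr_pow_add`
  (`(ω₁ ⊞ ω₂)^{g₁+g₂} = C(g₁+g₂, g₁) · ω₁^{g₁} ∧ ω₂^{g₂}`, the top of the product string through `1 ⊗ 1`, row g31-#11) and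
  `IsSymplectic.trace_inl_add_inr_top` (`τ_{ω₁⊞ω₂}(ω₁^{g₁} ∧ ω₂^{g₂}) = g₁! g₂!`).
* §3 **POINCARÉ DUALITY OF `⋀W`**: `trace_mul_swap_of_mem` (`τ(x ∧ y) = (−1)^{deg y} τ(y ∧ x)` for homogeneous `y`, ALL `x`),
  **`IsSymplectic.eq_zero_of_forall_trace_mul_eq_zero`** (`τ(x ∧ y) = 0` for all `y` ⟹ `x = 0`: the degree-`i` component of `x` is
  killed by every `y ∈ ⋀^{2g−i}`, hence vanishes by the wedge duality `eq_zero_of_forall_wedgeProduct_eq_zero` of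
  `HodgeStructureExteriorPowerDuality` and `trace_eq_zero_iff`), its mirror `IsSymplectic.eq_zero_of_forall_trace_mul_eq_zero'`, and
  **`IsSymplectic.nondegenerate_trace_mul`: the Poincaré pairing `(x, y) ↦ τ_ω(x ∧ y)` is non-degenerate on the WHOLE exterior
  algebra.**
* §4 **THE GYSIN MAP OF THE SECOND PROJECTION `gysinSnd ω₁ g₁ : ⋀(W₁ × W₂) →ₗ[K] ⋀W₂`** ("integration along `W₁`"):
  `gysinSnd_kunnethEquiv_tmul` (`q_*(p^*a ∪ q^*b) = τ_{ω₁}(a) · b`), `gysinSnd_map_inl` (`q_* p^* a = τ_{ω₁}(a) · 1`),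
  `gysinSnd_mul_map_inr` / `gysinSnd_map_inr_mul` (`q_*(u ∪ q^*y) = q_*u ∪ y`, `q_*(q^*y ∪ u) = y ∪ q_*u` — the projection formula in
  push–pull form), **THE PROJECTION FORMULA `IsSymplectic.trace_map_inr_mul_eq`: `η_{A×B}(q^*y ∪ u) = η_B(y ∪ q_*u)`** and its mirror
  `IsSymplectic.trace_mul_map_inr_eq` (`η_{A×B}(u ∪ q^*y) = η_B(q_*u ∪ y)`, Milne's "`η_B(φ_*(x) ∪ y) = η_A(x ∪ φ^*(y))`" for `φ = q`),
  which CHARACTERISES `q_*` by §3: **`IsSymplectic.eq_gysinSnd_of_forall_trace_mul_eq`**.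

TWIN NOTICE (RULING 29 bis). The torus-forms carriers of the lane have their own Künneth/Gysin/correspondence package
(`Geometry/Kaehler/ComplexTorusKunnethHomHodgeStructure` — `tensorToHomMap`; `Geometry/Kaehler/ComplexTorusLefschetzAlgebraCorrespondences`,
`…CorrespondenceRing*`; `AlgebraicGeometry/HodgeTheory/ComplexTorusIntegral*`, `…/CorrespondenceAction`, `…/GysinExteriorProduct`);
nothing of those files is imported or restated here (the Motives layer does not import the Kähler layer); the present file is the
coordinate-free exterior-algebra statement over an arbitrary field of characteristic `0`.

## References

* [Milne1999LefschetzClasses] J. S. Milne, *Lefschetz classes on abelian varieties*, Duke Math. J. 96 (1999), §5 pp. 662–664.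
* [VoisinHodgeI2002] C. Voisin, *Hodge Theory and Complex Algebraic Geometry I* (2002), §11.3.3, Thm. 11.38, (11.11).
* [BourbakiAlgebraI1989] N. Bourbaki, *Algebra I, Chapters 1–3* (1989), Ch. III §7 no. 7 Prop. 10 and Remark; §7 no. 1; §11 no. 11
  (interior products / duality of the exterior algebra).
* [Lange2023AbelianVarietiesComplex] H. Lange, *Abelian Varieties over the Complex Numbers* (2023), §6.2.2 Thm. 6.2.4, (6.8).
-/

noncomputable section

open scoped TensorProduct Nat

namespace Literature.AlgebraicGeometry.Motives

namespace ExteriorLefschetz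

open Literature.Algebra.Lie ExteriorAlgebra
open Literature.LinearAlgebra.Alternating (mul_comm_of_mem_exteriorPower map_coe_mem_exteriorPower extGrading ι_mem_exteriorPower_one)

variable {K : Type*} [Field K] {W₁ W₂ : Type*} [AddCommGroup W₁] [Module K W₁] [AddCommGroup W₂] [Module K W₂]

/-! ## §1 The Künneth isomorphism as a linear equivalence `⋀W₁ ⊗ ⋀W₂ ≃ ⋀(W₁ × W₂)` -/

variable (K W₁ W₂) in
/-- **The Künneth isomorphism `Φ : ⋀W₁ ⊗ ⋀W₂ ≃ ⋀(W₁ ⊕ W₂)`, `x ⊗ y ↦ ⋀(inl) x ∧ ⋀(inr) y`** — Bourbaki's graded-algebra isomorphism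
`g : ⋀(M) ᵍ⊗ ⋀(N) → ⋀(M ⊕ N)` (the tree's `ExteriorDirectSum.toProd`, an isomorphism by Prop. 10 = `prodEquiv`) read on the
ORDINARY tensor product through the cast `GradedTensorProduct.of`, as a `K`-linear equivalence ("the cup-products
`Hᵖ(X) ⊗ H^q(Y) → H^{p+q}(X × Y)` induce an isomorphism"). [cite: BourbakiAlgebraI1989, Ch. III §7 no. 7 Prop. 10 (formula (14))]
[cite: VoisinHodgeI2002, §11.3.3 Thm. 11.38] -/
def kunnethEquiv : (ExteriorAlgebra K W₁ ⊗[K] ExteriorAlgebra K W₂) ≃ₗ[K] ExteriorAlgebra K (W₁ × W₂) :=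
  (GradedTensorProduct.of K (extGrading K W₁) (extGrading K W₂)).trans
    (Literature.LinearAlgebra.Alternating.ExteriorDirectSum.prodEquiv K W₁ W₂).symm.toLinearEquiv

/-- `Φ(x ⊗ y) = ⋀(inl) x ∧ ⋀(inr) y`. [cite: BourbakiAlgebraI1989, Ch. III §7 no. 7 Prop. 10 (formula (14))] -/
@[simp]
theorem kunnethEquiv_tmul (x : ExteriorAlgebra K W₁) (y : ExteriorAlgebra K W₂) :
    kunnethEquiv K W₁ W₂ (x ⊗ₜ[K] y) =
      ExteriorAlgebra.map (LinearMap.inl K W₁ W₂) x * ExteriorAlgebra.map (LinearMap.inr K W₁ W₂) y :=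
  Literature.LinearAlgebra.Alternating.ExteriorDirectSum.toProd_tmul K W₁ W₂ x y

/-- `Φ` IS the map `toProd ∘ of` of row g31-#9 (so that `toProd_of_rTensor_add_lTensor_mul`, `…_shiftedDegree` and the transports of that
row are statements about `kunnethEquiv`). [cite: BourbakiAlgebraI1989, Ch. III §7 no. 7 Prop. 10 (formula (14))] -/
theorem coe_kunnethEquiv :
    (kunnethEquiv K W₁ W₂ : ExteriorAlgebra K W₁ ⊗[K] ExteriorAlgebra K W₂ →ₗ[K] ExteriorAlgebra K (W₁ × W₂)) =
      (Literature.LinearAlgebra.Alternating.ExteriorDirectSum.toProd K W₁ W₂).toLinearMap ∘ₗ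
        (GradedTensorProduct.of K (extGrading K W₁) (extGrading K W₂)).toLinearMap :=
  rfl

/-- `Φ(⋀ᵃW₁ ⊗ ⋀ᵇW₂) ⊆ ⋀^{a+b}(W₁ × W₂)` (`g` is graded). [cite: BourbakiAlgebraI1989, Ch. III §7 no. 7 Prop. 10 and Cor.] -/
theorem kunnethEquiv_tmul_mem {a b : ℕ} {x : ExteriorAlgebra K W₁} {y : ExteriorAlgebra K W₂} (hx : x ∈ ⋀[K]^a W₁)
    (hy : y ∈ ⋀[K]^b W₂) : kunnethEquiv K W₁ W₂ (x ⊗ₜ[K] y) ∈ ⋀[K]^(a + b) (W₁ × W₂) := by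
  rw [kunnethEquiv_tmul]
  exact map_inl_mul_map_inr_mem_exteriorPower hx hy

/-- `(f₁ × f₂) ∘ inl = inl ∘ f₁`. [cite: BourbakiAlgebraI1989, Ch. II §1 no. 6 (products of modules)] -/
private theorem prodMap_comp_inl {W₁' W₂' : Type*} [AddCommGroup W₁'] [Module K W₁'] [AddCommGroup W₂'] [Module K W₂']
    (f₁ : W₁ →ₗ[K] W₁') (f₂ : W₂ →ₗ[K] W₂') :
    (f₁.prodMap f₂) ∘ₗ LinearMap.inl K W₁ W₂ = LinearMap.inl K W₁' W₂' ∘ₗ f₁ := by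
  ext v <;> simp

/-- `(f₁ × f₂) ∘ inr = inr ∘ f₂`. [cite: BourbakiAlgebraI1989, Ch. II §1 no. 6 (products of modules)] -/
private theorem prodMap_comp_inr {W₁' W₂' : Type*} [AddCommGroup W₁'] [Module K W₁'] [AddCommGroup W₂'] [Module K W₂']
    (f₁ : W₁ →ₗ[K] W₁') (f₂ : W₂ →ₗ[K] W₂') :
    (f₁.prodMap f₂) ∘ₗ LinearMap.inr K W₁ W₂ = LinearMap.inr K W₁' W₂' ∘ₗ f₂ := by
  ext v <;> simp

/-- **NATURALITY of `Φ` (Bourbaki's Remark after Prop. 10): `⋀(f₁ × f₂) (Φ t) = Φ ((⋀f₁ ⊗ ⋀f₂) t)`.**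
[cite: BourbakiAlgebraI1989, Ch. III §7 no. 7, Remark after Prop. 10] -/
theorem map_prodMap_kunnethEquiv {W₁' W₂' : Type*} [AddCommGroup W₁'] [Module K W₁'] [AddCommGroup W₂'] [Module K W₂']
    (f₁ : W₁ →ₗ[K] W₁') (f₂ : W₂ →ₗ[K] W₂') (t : ExteriorAlgebra K W₁ ⊗[K] ExteriorAlgebra K W₂) :
    ExteriorAlgebra.map (f₁.prodMap f₂) (kunnethEquiv K W₁ W₂ t) =
      kunnethEquiv K W₁' W₂' (TensorProduct.map (ExteriorAlgebra.map f₁).toLinearMap (ExteriorAlgebra.map f₂).toLinearMap t) := by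
  induction t using TensorProduct.induction_on with
  | zero => simp only [map_zero]
  | add a b ha hb => simp only [map_add, ha, hb]
  | tmul x y =>
    rw [TensorProduct.map_tmul, AlgHom.toLinearMap_apply, AlgHom.toLinearMap_apply, kunnethEquiv_tmul, kunnethEquiv_tmul, map_mul,
      ← AlgHom.comp_apply, ← AlgHom.comp_apply, map_comp_map, map_comp_map, prodMap_comp_inl, prodMap_comp_inr, ← map_comp_map,
      ← map_comp_map, AlgHom.comp_apply, AlgHom.comp_apply]

/-! ## §2 The product formula `∫_{X×Y} p^*a ∪ q^*b = ∫_X a · ∫_Y b` -/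

section Symplectic

variable [CharZero K] {ω₁ : ExteriorAlgebra K W₁} {ω₂ : ExteriorAlgebra K W₂} {g₁ g₂ : ℕ}

/-- **`(ω₁ ⊞ ω₂)^{g₁+g₂} = C(g₁+g₂, g₁) · ⋀(inl) ω₁^{g₁} ∧ ⋀(inr) ω₂^{g₂}`** (the binomial expansion of commuting even elements, all
other terms vanishing since `ωᵢ^{gᵢ+1} = 0`: the top of the product string through `1 ⊗ 1`, row g31-#11 with `p = q = 1 ∈ P⁰`).
[cite: Andre1996Motifs, §1.3 Lemme 1.3.1 (p. 13, proof)] [cite: BourbakiAlgebraI1989, Ch. III §7 no. 7 Prop. 10] -/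
theorem IsSymplectic.inl_add_inr_pow_add (hω₁ : IsSymplectic ω₁ g₁) (hω₂ : IsSymplectic ω₂ g₂) :
    (ExteriorAlgebra.map (LinearMap.inl K W₁ W₂) ω₁ + ExteriorAlgebra.map (LinearMap.inr K W₁ W₂) ω₂) ^ (g₁ + g₂) =
      (((g₁ + g₂).choose g₁ : ℕ) : K) •
        (ExteriorAlgebra.map (LinearMap.inl K W₁ W₂) (ω₁ ^ g₁) * ExteriorAlgebra.map (LinearMap.inr K W₁ W₂) (ω₂ ^ g₂)) := by
  have hp : (1 : ExteriorAlgebra K W₁) ∈ primitive ω₁ g₁ 0 := by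
    refine mem_primitive_iff.2 ⟨SetLike.one_mem_graded _, ?_⟩
    rw [mul_one, Nat.sub_zero]
    exact (Submodule.eq_bot_iff _).mp (hω₁.exteriorPower_eq_bot_of_lt (2 * (g₁ + 1)) (by omega)) _
      (pow_mem_exteriorPower hω₁.mem (g₁ + 1))
  have hq : (1 : ExteriorAlgebra K W₂) ∈ primitive ω₂ g₂ 0 := by
    refine mem_primitive_iff.2 ⟨SetLike.one_mem_graded _, ?_⟩
    rw [mul_one, Nat.sub_zero]
    exact (Submodule.eq_bot_iff _).mp (hω₂.exteriorPower_eq_bot_of_lt (2 * (g₂ + 1)) (by omega)) _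
      (pow_mem_exteriorPower hω₂.mem (g₂ + 1))
  have key := inl_add_inr_pow_mul_of_mem_primitive ω₁ hω₂.mem (Nat.zero_le g₁) (Nat.zero_le g₂) hp hq
  simp only [Nat.sub_zero, map_one, mul_one] at key
  exact key

/-- **`τ_{ω₁⊞ω₂}(ω₁^{g₁} ∧ ω₂^{g₂}) = g₁! · g₂!`** (`τ_{ω₁⊞ω₂}((ω₁ ⊞ ω₂)^{g₁+g₂}) = (g₁+g₂)!` and `C(g₁+g₂, g₁) g₁! g₂! = (g₁+g₂)!`).
[cite: Milne1999LefschetzClasses, §5 p. 663 (η_A, η_B, η_{A×B})] [cite: VoisinHodgeI2002, §11.3.3 Thm. 11.38] -/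
theorem IsSymplectic.trace_inl_add_inr_top (hω₁ : IsSymplectic ω₁ g₁) (hω₂ : IsSymplectic ω₂ g₂) :
    trace (ExteriorAlgebra.map (LinearMap.inl K W₁ W₂) ω₁ + ExteriorAlgebra.map (LinearMap.inr K W₁ W₂) ω₂) (g₁ + g₂)
        (ExteriorAlgebra.map (LinearMap.inl K W₁ W₂) (ω₁ ^ g₁) * ExteriorAlgebra.map (LinearMap.inr K W₁ W₂) (ω₂ ^ g₂)) =
      ((g₁ ! : ℕ) : K) * ((g₂ ! : ℕ) : K) := by
  have hΩ := hω₁.inl_add_inr hω₂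
  have h1 := hΩ.trace_pow
  rw [hω₁.inl_add_inr_pow_add hω₂, map_smul, smul_eq_mul] at h1
  have hc : (((g₁ + g₂).choose g₁ : ℕ) : K) ≠ 0 := by
    rw [Nat.cast_ne_zero]; exact (Nat.choose_pos (Nat.le_add_right g₁ g₂)).ne'
  have hfact : (((g₁ + g₂) ! : ℕ) : K) = (((g₁ + g₂).choose g₁ : ℕ) : K) * (((g₁ ! : ℕ) : K) * ((g₂ ! : ℕ) : K)) := by
    rw [← Nat.cast_mul, ← Nat.cast_mul, ← mul_assoc, Nat.choose_symm_add, Nat.add_choose_mul_factorial_mul_factorial]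
  rw [hfact] at h1
  exact mul_left_cancel₀ hc h1

/-- **THE PRODUCT FORMULA `τ_{ω₁⊞ω₂}(Φ(a ⊗ b)) = τ_{ω₁}(a) · τ_{ω₂}(b)`** ("`∫_{X×Y} p^*a ∪ q^*b = ∫_X a · ∫_Y b`"): both sides are
bilinear, so it suffices to treat homogeneous `a ∈ ⋀ⁱW₁`, `b ∈ ⋀ʲW₂`; for `(i, j) = (2g₁, 2g₂)` write `g₁! a = τ(a) ω₁^{g₁}`,
`g₂! b = τ(b) ω₂^{g₂}` and use `trace_inl_add_inr_top`; otherwise both sides vanish (`Φ(a ⊗ b) ∈ ⋀^{i+j}`, and `⋀^{>2g} = 0`).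
[cite: Milne1999LefschetzClasses, §5 p. 663] [cite: VoisinHodgeI2002, §11.3.3 Thm. 11.38] -/
theorem IsSymplectic.trace_kunnethEquiv_tmul (hω₁ : IsSymplectic ω₁ g₁) (hω₂ : IsSymplectic ω₂ g₂) (a : ExteriorAlgebra K W₁)
    (b : ExteriorAlgebra K W₂) :
    trace (ExteriorAlgebra.map (LinearMap.inl K W₁ W₂) ω₁ + ExteriorAlgebra.map (LinearMap.inr K W₁ W₂) ω₂) (g₁ + g₂)
        (kunnethEquiv K W₁ W₂ (a ⊗ₜ[K] b)) =
      trace ω₁ g₁ a * trace ω₂ g₂ b := by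
  induction a using DirectSum.Decomposition.inductionOn (fun i : ℕ ↦ ⋀[K]^i W₁) with
  | zero => rw [TensorProduct.zero_tmul, map_zero, map_zero, map_zero, zero_mul]
  | add a a' ha ha' => rw [TensorProduct.add_tmul, map_add, map_add, ha, ha', map_add, add_mul]
  | @homogeneous i x =>
    induction b using DirectSum.Decomposition.inductionOn (fun i : ℕ ↦ ⋀[K]^i W₂) with
    | zero => rw [TensorProduct.tmul_zero, map_zero, map_zero, map_zero, mul_zero]
    | add b b' hb hb' => rw [TensorProduct.tmul_add, map_add, map_add, hb, hb', map_add, mul_add]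
    | @homogeneous j y =>
      by_cases hij : i = 2 * g₁ ∧ j = 2 * g₂
      · obtain ⟨rfl, rfl⟩ := hij
        have hx := hω₁.factorial_smul_eq_trace_smul_pow x.2
        have hy := hω₂.factorial_smul_eq_trace_smul_pow y.2
        have h1 : ((g₁ ! : ℕ) : K) ≠ 0 := by exact_mod_cast (g₁).factorial_ne_zero
        have h2 : ((g₂ ! : ℕ) : K) ≠ 0 := by exact_mod_cast (g₂).factorial_ne_zero
        have key : (((g₁ ! : ℕ) : K) * ((g₂ ! : ℕ) : K)) *
            trace (ExteriorAlgebra.map (LinearMap.inl K W₁ W₂) ω₁ + ExteriorAlgebra.map (LinearMap.inr K W₁ W₂) ω₂) (g₁ + g₂)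
              (kunnethEquiv K W₁ W₂ ((x : ExteriorAlgebra K W₁) ⊗ₜ[K] (y : ExteriorAlgebra K W₂))) =
            (((g₁ ! : ℕ) : K) * ((g₂ ! : ℕ) : K)) * (trace ω₁ g₁ x * trace ω₂ g₂ y) := by
          calc _ = trace (ExteriorAlgebra.map (LinearMap.inl K W₁ W₂) ω₁ + ExteriorAlgebra.map (LinearMap.inr K W₁ W₂) ω₂) (g₁ + g₂)
                (kunnethEquiv K W₁ W₂
                  ((((g₁ ! : ℕ) : K) • (x : ExteriorAlgebra K W₁)) ⊗ₜ[K] (((g₂ ! : ℕ) : K) • (y : ExteriorAlgebra K W₂)))) := by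
                rw [TensorProduct.smul_tmul_smul, map_smul, map_smul, smul_eq_mul]
            _ = _ := by
                rw [hx, hy, kunnethEquiv_tmul, map_smul, map_smul, smul_mul_assoc, mul_smul_comm, smul_smul, map_smul,
                  hω₁.trace_inl_add_inr_top hω₂, smul_eq_mul]
                ring
        exact mul_left_cancel₀ (mul_ne_zero h1 h2) key
      · -- one of the two traces on the right vanishes, and so does the left-hand side
        have hR : trace ω₁ g₁ x * trace ω₂ g₂ y = 0 := by
          by_cases hi : i = 2 * g₁
          · have hj : j ≠ 2 * g₂ := fun hj ↦ hij ⟨hi, hj⟩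
            rw [trace_apply_of_mem_ne y.2 hj, mul_zero]
          · rw [trace_apply_of_mem_ne x.2 hi, zero_mul]
        rw [hR]
        by_cases hsum : i + j = 2 * (g₁ + g₂)
        · -- then one of the degrees exceeds its top degree, and that factor is zero
          by_cases hi : 2 * g₁ < i
          · have hx0 : (x : ExteriorAlgebra K W₁) = 0 :=
              (Submodule.eq_bot_iff _).mp (hω₁.exteriorPower_eq_bot_of_lt i hi) _ x.2
            rw [hx0, TensorProduct.zero_tmul, map_zero, map_zero]
          · have hj : 2 * g₂ < j := by
              rcases Nat.lt_or_ge i (2 * g₁) with h | h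
              · omega
              · exact absurd ⟨by omega, by omega⟩ hij
            have hy0 : (y : ExteriorAlgebra K W₂) = 0 :=
              (Submodule.eq_bot_iff _).mp (hω₂.exteriorPower_eq_bot_of_lt j hj) _ y.2
            rw [hy0, TensorProduct.tmul_zero, map_zero, map_zero]
        · exact trace_apply_of_mem_ne (kunnethEquiv_tmul_mem x.2 y.2) hsum

/-- The product formula in `∧`-form: **`τ_{ω₁⊞ω₂}(⋀(inl) a ∧ ⋀(inr) b) = τ_{ω₁}(a) · τ_{ω₂}(b)`.**
[cite: Milne1999LefschetzClasses, §5 p. 663] [cite: VoisinHodgeI2002, §11.3.3 Thm. 11.38] -/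
theorem IsSymplectic.trace_map_inl_mul_map_inr (hω₁ : IsSymplectic ω₁ g₁) (hω₂ : IsSymplectic ω₂ g₂) (a : ExteriorAlgebra K W₁)
    (b : ExteriorAlgebra K W₂) :
    trace (ExteriorAlgebra.map (LinearMap.inl K W₁ W₂) ω₁ + ExteriorAlgebra.map (LinearMap.inr K W₁ W₂) ω₂) (g₁ + g₂)
        (ExteriorAlgebra.map (LinearMap.inl K W₁ W₂) a * ExteriorAlgebra.map (LinearMap.inr K W₁ W₂) b) =
      trace ω₁ g₁ a * trace ω₂ g₂ b := by
  rw [← kunnethEquiv_tmul, hω₁.trace_kunnethEquiv_tmul hω₂]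

/-! ## §3 Poincaré duality of the exterior algebra of a symplectic space -/

variable {W : Type*} [AddCommGroup W] [Module K W] {ω : ExteriorAlgebra K W} {g : ℕ}

/-- **`τ(x ∧ y) = (−1)^{deg y} τ(y ∧ x)`** for homogeneous `y ∈ ⋀ᶜW` and EVERY `x` (only the component of `x` of degree `2g − c`
contributes, and `(−1)^{(2g−c)c} = (−1)^c`). [cite: BourbakiAlgebraI1989, Ch. III §7 no. 1 (graded commutativity)]
[cite: Andre1996Motifs, §1.1 (p. 11, "l'accouplement de dualité de Poincaré")] -/
theorem trace_mul_swap_of_mem (x : ExteriorAlgebra K W) {c : ℕ} {y : ExteriorAlgebra K W}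
    (hy : y ∈ ⋀[K]^c W) : trace ω g (x * y) = ((-1 : K) ^ c) • trace ω g (y * x) := by
  induction x using DirectSum.Decomposition.inductionOn (fun i : ℕ ↦ ⋀[K]^i W) with
  | zero => rw [zero_mul, mul_zero, map_zero, smul_zero]
  | add x x' hx hx' => rw [add_mul, mul_add, map_add, map_add, hx, hx', smul_add]
  | @homogeneous i x =>
    by_cases hic : i + c = 2 * g
    · rw [mul_comm_of_mem x.2 hy, map_smul]
      congr 1
      have hi : i = 2 * g - c := by omega
      subst hi
      rcases Nat.even_or_odd c with ⟨r, hr⟩ | ⟨r, hr⟩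
      · rw [hr, show (2 * g - (r + r)) * (r + r) = 2 * ((2 * g - (r + r)) * r) by ring, pow_mul, neg_one_sq, one_pow,
          show r + r = 2 * r by ring, pow_mul, neg_one_sq, one_pow]
      · have h1 : (2 * g - c) * c = 2 * (((2 * g - c) * c) / 2) + 1 := by
          have hodd : Odd ((2 * g - c) * c) := Nat.odd_mul.2 ⟨by rw [hr]; exact ⟨g - r - 1, by omega⟩, ⟨r, hr⟩⟩
          obtain ⟨m, hm⟩ := hodd; omega
        rw [h1, pow_succ, pow_mul, neg_one_sq, one_pow, one_mul, hr, pow_succ, pow_mul, neg_one_sq, one_pow, one_mul]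
    · rw [trace_mul_eq_zero_of_add_ne x.2 hy hic, trace_mul_eq_zero_of_add_ne hy x.2 (by omega), smul_zero]

/-- **POINCARÉ DUALITY: `τ(x ∧ y) = 0` for all `y` forces `x = 0`** (for EVERY `x ∈ ⋀W`): pairing with `y ∈ ⋀^{2g−i}W` isolates the
degree-`i` component `xᵢ` of `x`, so `τ(xᵢ ∧ y) = 0`, i.e. `xᵢ ∧ y = 0` (`⋀^{2g}W = K ω^g`), for all such `y`; the wedge pairing
`⋀ⁱ × ⋀^{2g−i} → ⋀^{2g}` being perfect, `xᵢ = 0`. [cite: BourbakiAlgebraI1989, Ch. III §11 no. 11 (duality of the exterior algebra)]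
[cite: VoisinHodgeI2002, §7.3.2, proof of Lemma 7.28 (Poincaré duality)] -/
theorem IsSymplectic.eq_zero_of_forall_trace_mul_eq_zero (hω : IsSymplectic ω g) {x : ExteriorAlgebra K W}
    (h : ∀ y : ExteriorAlgebra K W, trace ω g (x * y) = 0) : x = 0 := by
  classical
  haveI := hω.finite
  rw [← DirectSum.sum_support_decompose (fun i : ℕ ↦ ⋀[K]^i W) x]
  refine Finset.sum_eq_zero fun i _ ↦ ?_
  by_cases hi : i ≤ 2 * g
  · have key : ∀ y : ⋀[K]^(2 * g - i) W,
        ((DirectSum.decompose (fun i : ℕ ↦ ⋀[K]^i W) x i : ⋀[K]^i W) : ExteriorAlgebra K W) * (y : ExteriorAlgebra K W) = 0 := by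
      intro y
      have h1 : trace ω g (((DirectSum.decompose (fun i : ℕ ↦ ⋀[K]^i W) x i : ⋀[K]^i W) : ExteriorAlgebra K W) * y) =
          trace ω g (x * y) := by
        conv_rhs => rw [← DirectSum.sum_support_decompose (fun i : ℕ ↦ ⋀[K]^i W) x, Finset.sum_mul, map_sum]
        rw [Finset.sum_eq_single i]
        · intro j _ hji
          exact trace_mul_eq_zero_of_add_ne (DirectSum.decompose (fun i : ℕ ↦ ⋀[K]^i W) x j).2 y.2 (by omega)
        · intro hi'
          rw [DFinsupp.notMem_support_iff.mp hi', ZeroMemClass.coe_zero, zero_mul, map_zero]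
      have h2 := h1.trans (h y)
      have hmem : ((DirectSum.decompose (fun i : ℕ ↦ ⋀[K]^i W) x i : ⋀[K]^i W) : ExteriorAlgebra K W) * y ∈ ⋀[K]^(2 * g) W := by
        have := SetLike.mul_mem_graded (DirectSum.decompose (fun i : ℕ ↦ ⋀[K]^i W) x i).2 y.2
        rwa [show i + (2 * g - i) = 2 * g by omega] at this
      exact (hω.trace_eq_zero_iff hmem).1 h2
    have h0 := eq_zero_of_forall_wedgeProduct_eq_zero (K := K) (W := W) (k := i) (l := 2 * g - i) (by rw [hω.finrank_eq]; omega)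
      (x := DirectSum.decompose (fun i : ℕ ↦ ⋀[K]^i W) x i) fun y ↦ Subtype.ext (by rw [coe_wedgeProduct, key y]; rfl)
    rw [h0]; rfl
  · exact (Submodule.eq_bot_iff _).mp (hω.exteriorPower_eq_bot_of_lt i (by omega)) _
      (DirectSum.decompose (fun i : ℕ ↦ ⋀[K]^i W) x i).2

/-- **The mirror statement: `τ(y ∧ x) = 0` for all `y` forces `x = 0`** (`τ(x ∧ y) = ±τ(y ∧ x)` for homogeneous `y`).
[cite: BourbakiAlgebraI1989, Ch. III §11 no. 11] [cite: VoisinHodgeI2002, §7.3.2, proof of Lemma 7.28] -/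
theorem IsSymplectic.eq_zero_of_forall_trace_mul_eq_zero' (hω : IsSymplectic ω g) {x : ExteriorAlgebra K W}
    (h : ∀ y : ExteriorAlgebra K W, trace ω g (y * x) = 0) : x = 0 := by
  refine hω.eq_zero_of_forall_trace_mul_eq_zero fun y ↦ ?_
  induction y using DirectSum.Decomposition.inductionOn (fun i : ℕ ↦ ⋀[K]^i W) with
  | zero => rw [mul_zero, map_zero]
  | add y y' hy hy' => rw [mul_add, map_add, hy, hy', add_zero]
  | homogeneous y => rw [trace_mul_swap_of_mem x y.2, h, smul_zero]

/-- **The Poincaré pairing `(x, y) ↦ τ_ω(x ∧ y)` of `⋀W` is non-degenerate** (on the whole exterior algebra, both sides).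
[cite: BourbakiAlgebraI1989, Ch. III §11 no. 11] [cite: Andre1996Motifs, §1.1 (p. 11, "dualité de Poincaré")] -/
theorem IsSymplectic.nondegenerate_trace_mul (hω : IsSymplectic ω g) :
    ((LinearMap.mul K (ExteriorAlgebra K W)).compr₂ (trace ω g)).Nondegenerate := by
  refine ⟨fun x hx ↦ hω.eq_zero_of_forall_trace_mul_eq_zero fun y ↦ ?_,
    fun y hy ↦ hω.eq_zero_of_forall_trace_mul_eq_zero' fun x ↦ ?_⟩
  · simpa only [LinearMap.compr₂_apply, LinearMap.mul_apply'] using hx y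
  · simpa only [LinearMap.compr₂_apply, LinearMap.mul_apply'] using hy x

/-! ## §4 The Gysin map `q_*` of the second projection and the projection formula -/

variable (ω₁ g₁) in
/-- **The Gysin map `q_* : ⋀(W₁ ⊕ W₂) → ⋀W₂` of the second projection** ("integration along the fibre `W₁`"): on Künneth tensors
`q_*(Φ(a ⊗ b)) = τ_{ω₁}(a) · b`, i.e. `q_* = (τ_{ω₁} ⊗ 1) ∘ Φ⁻¹` — the push-forward `φ_* : H^s(X) → H^{s+2c}(Y)`, `c = dim Y − dim X
= −d`, for `φ = q : A × B → B`, characterised by the projection formula (`IsSymplectic.eq_gysinSnd_of_forall_trace_mul_eq`).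
[cite: Milne1999LefschetzClasses, §5 pp. 662–664 (φ_*, q_*)] [cite: Lange2023AbelianVarietiesComplex, §6.2.2 (6.8)] -/
def gysinSnd : ExteriorAlgebra K (W₁ × W₂) →ₗ[K] ExteriorAlgebra K W₂ :=
  (TensorProduct.lid K (ExteriorAlgebra K W₂)).toLinearMap ∘ₗ (trace ω₁ g₁).rTensor (ExteriorAlgebra K W₂) ∘ₗ
    (kunnethEquiv K W₁ W₂).symm.toLinearMap

/-- **`q_*(p^*a ∪ q^*b) = τ_{ω₁}(a) · b`** (on Künneth tensors). [cite: Milne1999LefschetzClasses, §5 p. 664] [cite: Lange2023AbelianVarietiesComplex, §6.2.2 (6.8)] -/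
@[simp]
theorem gysinSnd_kunnethEquiv_tmul (a : ExteriorAlgebra K W₁) (b : ExteriorAlgebra K W₂) :
    gysinSnd ω₁ g₁ (kunnethEquiv K W₁ W₂ (a ⊗ₜ[K] b)) = trace ω₁ g₁ a • b := by
  simp only [gysinSnd, LinearMap.comp_apply, LinearEquiv.coe_toLinearMap, LinearEquiv.symm_apply_apply, LinearMap.rTensor_tmul,
    TensorProduct.lid_tmul]

/-- `q_*(⋀(inl) a ∧ ⋀(inr) b) = τ_{ω₁}(a) · b`. [cite: Milne1999LefschetzClasses, §5 p. 664] -/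
theorem gysinSnd_map_inl_mul_map_inr (a : ExteriorAlgebra K W₁) (b : ExteriorAlgebra K W₂) :
    gysinSnd ω₁ g₁ (ExteriorAlgebra.map (LinearMap.inl K W₁ W₂) a * ExteriorAlgebra.map (LinearMap.inr K W₁ W₂) b) =
      trace ω₁ g₁ a • b := by
  rw [← kunnethEquiv_tmul, gysinSnd_kunnethEquiv_tmul]

/-- **`q_* p^* a = τ_{ω₁}(a) · 1`** (`p^*a = Φ(a ⊗ 1)`). [cite: Milne1999LefschetzClasses, §5 pp. 662–664] -/
theorem gysinSnd_map_inl (a : ExteriorAlgebra K W₁) :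
    gysinSnd ω₁ g₁ (ExteriorAlgebra.map (LinearMap.inl K W₁ W₂) a) = algebraMap K (ExteriorAlgebra K W₂) (trace ω₁ g₁ a) := by
  rw [← mul_one (ExteriorAlgebra.map (LinearMap.inl K W₁ W₂) a), ← map_one (ExteriorAlgebra.map (LinearMap.inr K W₁ W₂)),
    gysinSnd_map_inl_mul_map_inr, Algebra.algebraMap_eq_smul_one]

/-- **`q_* q^* y = τ_{ω₁}(1) · y`** (zero unless `g₁ = 0`). [cite: Milne1999LefschetzClasses, §5 pp. 662–664] -/
theorem gysinSnd_map_inr (y : ExteriorAlgebra K W₂) :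
    gysinSnd ω₁ g₁ (ExteriorAlgebra.map (LinearMap.inr K W₁ W₂) y) = trace ω₁ g₁ 1 • y := by
  rw [← one_mul (ExteriorAlgebra.map (LinearMap.inr K W₁ W₂) y), ← map_one (ExteriorAlgebra.map (LinearMap.inl K W₁ W₂)),
    gysinSnd_map_inl_mul_map_inr]

/-- **`q_*(u ∪ q^*y) = q_*u ∪ y`** (projection formula, push–pull form; no sign since `q^*y` is on the right).
[cite: Milne1999LefschetzClasses, §5 p. 663 (projection formula)] [cite: Lange2023AbelianVarietiesComplex, §6.2.2 Thm. 6.2.4] -/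
theorem gysinSnd_mul_map_inr (u : ExteriorAlgebra K (W₁ × W₂)) (y : ExteriorAlgebra K W₂) :
    gysinSnd ω₁ g₁ (u * ExteriorAlgebra.map (LinearMap.inr K W₁ W₂) y) = gysinSnd ω₁ g₁ u * y := by
  obtain ⟨t, rfl⟩ := (kunnethEquiv K W₁ W₂).surjective u
  induction t using TensorProduct.induction_on with
  | zero => rw [map_zero, zero_mul, map_zero, zero_mul]
  | add a b ha hb => rw [map_add, add_mul, map_add, ha, hb, map_add, add_mul]
  | tmul a b =>
    rw [kunnethEquiv_tmul, mul_assoc, ← map_mul, gysinSnd_map_inl_mul_map_inr, gysinSnd_map_inl_mul_map_inr, smul_mul_assoc]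

/-- **`q_*(q^*y ∪ u) = y ∪ q_*u`** (`q^*y` commutes past `p^*a` up to `(−1)^{deg y · deg a}`, and only `deg a = 2g₁` survives `τ_{ω₁}`).
[cite: Milne1999LefschetzClasses, §5 p. 663 (projection formula)] [cite: Lange2023AbelianVarietiesComplex, §6.2.2 Thm. 6.2.4] -/
theorem gysinSnd_map_inr_mul (y : ExteriorAlgebra K W₂) (u : ExteriorAlgebra K (W₁ × W₂)) :
    gysinSnd ω₁ g₁ (ExteriorAlgebra.map (LinearMap.inr K W₁ W₂) y * u) = y * gysinSnd ω₁ g₁ u := by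
  obtain ⟨t, rfl⟩ := (kunnethEquiv K W₁ W₂).surjective u
  induction t using TensorProduct.induction_on with
  | zero => rw [map_zero, mul_zero, map_zero, mul_zero]
  | add a b ha hb => rw [map_add, mul_add, map_add, ha, hb, map_add, mul_add]
  | tmul a b =>
    induction y using DirectSum.Decomposition.inductionOn (fun i : ℕ ↦ ⋀[K]^i W₂) with
    | zero => rw [map_zero, zero_mul, zero_mul, map_zero]
    | add y y' hy hy' => rw [map_add, add_mul, add_mul, map_add, hy, hy']
    | @homogeneous c y =>
      induction a using DirectSum.Decomposition.inductionOn (fun i : ℕ ↦ ⋀[K]^i W₁) with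
      | zero => rw [TensorProduct.zero_tmul, map_zero, mul_zero, map_zero, mul_zero]
      | add a a' ha ha' => rw [TensorProduct.add_tmul, map_add, mul_add, map_add, ha, ha', map_add, mul_add]
      | @homogeneous i a =>
        rw [kunnethEquiv_tmul, ← mul_assoc,
          mul_comm_of_mem (map_coe_mem_exteriorPower K (LinearMap.inr K W₁ W₂) y) (map_coe_mem_exteriorPower K (LinearMap.inl K W₁ W₂) a),
          smul_mul_assoc, mul_assoc, ← map_mul, map_smul, gysinSnd_map_inl_mul_map_inr, gysinSnd_map_inl_mul_map_inr, mul_smul_comm]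
        by_cases hi : i = 2 * g₁
        · subst hi; rw [show c * (2 * g₁) = 2 * (c * g₁) by ring, pow_mul, neg_one_sq, one_pow, one_smul]
        · rw [trace_apply_of_mem_ne a.2 hi, zero_smul, smul_zero]

/-- **THE PROJECTION FORMULA `η_{A×B}(q^*y ∪ u) = η_B(y ∪ q_*u)`** (for `u = Φ(a ⊗ b)` with `a ∈ ⋀ⁱ`, `y ∈ ⋀ᶜ`: the left side is
`(−1)^{ci} τ(a) τ(y ∧ b)` by the product formula, the right side `τ(a) τ(y ∧ b)`, and `τ(a) = 0` unless `i = 2g₁` is even).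
[cite: Milne1999LefschetzClasses, §5 p. 663 ("η_B(φ_*(x) ∪ y) = η_A(x ∪ φ^*(y))")] [cite: Lange2023AbelianVarietiesComplex, §6.2.2 Thm. 6.2.4] -/
theorem IsSymplectic.trace_map_inr_mul_eq (hω₁ : IsSymplectic ω₁ g₁) (hω₂ : IsSymplectic ω₂ g₂) (y : ExteriorAlgebra K W₂)
    (u : ExteriorAlgebra K (W₁ × W₂)) :
    trace (ExteriorAlgebra.map (LinearMap.inl K W₁ W₂) ω₁ + ExteriorAlgebra.map (LinearMap.inr K W₁ W₂) ω₂) (g₁ + g₂)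
        (ExteriorAlgebra.map (LinearMap.inr K W₁ W₂) y * u) =
      trace ω₂ g₂ (y * gysinSnd ω₁ g₁ u) := by
  obtain ⟨t, rfl⟩ := (kunnethEquiv K W₁ W₂).surjective u
  induction t using TensorProduct.induction_on with
  | zero => rw [map_zero, mul_zero, map_zero, map_zero, mul_zero, map_zero]
  | add a b ha hb => rw [map_add, mul_add, map_add, ha, hb, map_add, mul_add, map_add]
  | tmul a b =>
    induction y using DirectSum.Decomposition.inductionOn (fun i : ℕ ↦ ⋀[K]^i W₂) with
    | zero => rw [map_zero, zero_mul, zero_mul, map_zero, map_zero]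
    | add y y' hy hy' => rw [map_add, add_mul, add_mul, map_add, map_add, hy, hy']
    | @homogeneous c y =>
      induction a using DirectSum.Decomposition.inductionOn (fun i : ℕ ↦ ⋀[K]^i W₁) with
      | zero => rw [TensorProduct.zero_tmul, map_zero, mul_zero, map_zero, map_zero, mul_zero, map_zero]
      | add a a' ha ha' => rw [TensorProduct.add_tmul, map_add, mul_add, map_add, ha, ha', map_add, mul_add, map_add]
      | @homogeneous i a =>
        rw [kunnethEquiv_tmul, ← mul_assoc,
          mul_comm_of_mem (map_coe_mem_exteriorPower K (LinearMap.inr K W₁ W₂) y) (map_coe_mem_exteriorPower K (LinearMap.inl K W₁ W₂) a),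
          smul_mul_assoc, mul_assoc, ← map_mul, map_smul, hω₁.trace_map_inl_mul_map_inr hω₂, gysinSnd_map_inl_mul_map_inr,
          mul_smul_comm, map_smul, smul_eq_mul, smul_eq_mul]
        by_cases hi : i = 2 * g₁
        · subst hi; rw [show c * (2 * g₁) = 2 * (c * g₁) by ring, pow_mul, neg_one_sq, one_pow, one_mul]
        · rw [trace_apply_of_mem_ne a.2 hi, zero_mul, mul_zero]

/-- **The mirror projection formula `η_{A×B}(u ∪ q^*y) = η_B(q_*u ∪ y)`** (Milne's display for `φ = q`: "`η_B(φ_*(x) ∪ y) =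
η_A(x ∪ φ^*(y))`", no sign at all). [cite: Milne1999LefschetzClasses, §5 p. 663] [cite: Lange2023AbelianVarietiesComplex, §6.2.2 Thm. 6.2.4] -/
theorem IsSymplectic.trace_mul_map_inr_eq (hω₁ : IsSymplectic ω₁ g₁) (hω₂ : IsSymplectic ω₂ g₂) (u : ExteriorAlgebra K (W₁ × W₂))
    (y : ExteriorAlgebra K W₂) :
    trace (ExteriorAlgebra.map (LinearMap.inl K W₁ W₂) ω₁ + ExteriorAlgebra.map (LinearMap.inr K W₁ W₂) ω₂) (g₁ + g₂)
        (u * ExteriorAlgebra.map (LinearMap.inr K W₁ W₂) y) =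
      trace ω₂ g₂ (gysinSnd ω₁ g₁ u * y) := by
  obtain ⟨t, rfl⟩ := (kunnethEquiv K W₁ W₂).surjective u
  induction t using TensorProduct.induction_on with
  | zero => rw [map_zero, zero_mul, map_zero, map_zero, zero_mul, map_zero]
  | add a b ha hb => rw [map_add, add_mul, map_add, ha, hb, map_add, add_mul, map_add]
  | tmul a b =>
    rw [gysinSnd_kunnethEquiv_tmul, kunnethEquiv_tmul, mul_assoc, ← map_mul, hω₁.trace_map_inl_mul_map_inr hω₂, smul_mul_assoc,
      map_smul, smul_eq_mul]

/-- **The projection formula CHARACTERISES `q_*`**: if `η_{A×B}(q^*y ∪ u) = η_B(y ∪ z)` for all `y`, then `z = q_*u` (Poincaré duality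
of `⋀W₂`, §3). [cite: Milne1999LefschetzClasses, §5 p. 663 ("Since this holds for all y […]")] -/
theorem IsSymplectic.eq_gysinSnd_of_forall_trace_mul_eq (hω₁ : IsSymplectic ω₁ g₁) (hω₂ : IsSymplectic ω₂ g₂)
    {u : ExteriorAlgebra K (W₁ × W₂)} {z : ExteriorAlgebra K W₂}
    (h : ∀ y : ExteriorAlgebra K W₂,
      trace (ExteriorAlgebra.map (LinearMap.inl K W₁ W₂) ω₁ + ExteriorAlgebra.map (LinearMap.inr K W₁ W₂) ω₂) (g₁ + g₂)
          (ExteriorAlgebra.map (LinearMap.inr K W₁ W₂) y * u) =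
        trace ω₂ g₂ (y * z)) :
    z = gysinSnd ω₁ g₁ u := by
  rw [← sub_eq_zero]
  refine hω₂.eq_zero_of_forall_trace_mul_eq_zero' fun y ↦ ?_
  rw [mul_sub, map_sub, ← h y, hω₁.trace_map_inr_mul_eq hω₂, sub_self]

end Symplectic

end ExteriorLefschetz

end Literature.AlgebraicGeometry.Motives
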